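import Literature.AlgebraicGeometry.HodgeTheory.ProperModificationCohomologySpanning
import Literature.AlgebraicGeometry.HodgeTheory.ComplexOrientationDegreeOne
import Literature.AlgebraicGeometry.HodgeTheory.ComplexOrientationCycleClassFacts
import Literature.AlgebraicGeometry.HodgeTheory.ComplexGysinHodgeType
import Literature.AlgebraicGeometry.HodgeTheory.HodgeTypePullback
import Literature.AlgebraicGeometry.HodgeTheory.GysinFormalismCorrespondences
import Literature.AlgebraicGeometry.HodgeTheory.FermatAokiCycleInvariance
import Literature.AlgebraicGeometry.HodgeTheory.ArapuraSurfaceFibredFourfoldsProofs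
import Summits.HodgeConjecture.HodgeConjecture.Theorems.SoloInformedConiveauOne
import HarnessLib

/-!
# Coniveau one is a birational invariant — hence the Hodge conjecture is a statement about
# function fields

Family `hodge`; solo (informed) programme, second landing. Companion to
`Theorems/SoloInformedConiveauOne`, which proves (granted the tree's named facts)

  `HodgeConjecture ↔ C1`,  `C1(n, p)(X)`: every rational `(p,p)`-class of the smooth projective
  `n`-fold `X` lies in `N¹ H^{2p}(X(ℂ); ℂ) = supportedClasses X (2p) 1` (dies on a non-empty
  Zariski open subset), for `2 ≤ p`, `2p ≤ n`.

THIS FILE: **for each fixed `(n, p)` the property `C1(n, p)` is a birational invariant of smooth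
projective `n`-folds** — unconditionally in `p` and `n`, with no inductive knowledge of the Hodge
conjecture in lower dimensions (contrast: `HC(Bl_W X) ↔ HC(X) ∧ HC(W)` needs the conjecture for the
centre `W`). The point is that the classes supported on the exceptional locus of a birational
morphism have coniveau `≥ 1` FOR TRIVIAL REASONS, so they never have to be analysed.

* `soloInformed_complexGysin_map_of_isBirational` — `b_* b^* = id` on `H*(M(ℂ); ℂ)` for a birational
  morphism `b : Z ⟶ M` of smooth projective `n`-folds and the complex orientations (projection
  formula `complexGysin_cup` + `b_* 1 = 1`, the tree's `complexGysin_complexOrientationFamily_one_of_isBirational`,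
  Fulton Lemma 19.1.2 with degree one).
* pull-back of `N¹` along surjective morphisms and surjectivity of proper birational morphisms are
  the tree's `map_mem_supportedClasses_one_of_surjective` and `surjective_base_of_isBirational`.
* `soloInformed_coniveauOne_of_isBirational_target` — **ascent** `C1(Z) → C1(M)` along `b : Z ⟶ M`
  birational: `c = b_* b^* c`, `b^* c` is a rational `(p,p)`-class (`IsRationalClass.map`,
  `preservesHodgeType_of_nonempty_hodgeModel`), and `b_* N¹(Z) ⊆ N¹(M)` in equal dimensions
  (`complexGysin_mem_supportedClasses`).
* `soloInformed_coniveauOne_of_isBirational_source` — **descent** `C1(M) → C1(Z)`: by the spanning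
  half of the blow-up formula in the generality of a proper modification
  (`exists_restrictCompl_sub_map_eq_zero_of_isIso_restrict`: `z = b^* y + w` with `w` dying on the
  dense open `b⁻¹U` over which `b` is an isomorphism, so `w ∈ N¹(Z)`); then
  `y = b_* z - b_* w ∈ N¹(M)` because `b_* z` is a rational `(p,p)`-class on `M`
  (`isRationalClass_complexGysin_complexOrientationFamily`, `isOfHodgeType_complexGysin`) to which
  `C1(M)` applies and `b_* w ∈ b_* N¹(Z) ⊆ N¹(M)`; finally `b^* y ∈ N¹(Z)`.
* `soloInformed_coniveauOne_iff_of_isBirational` — the two combined; and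
  `soloInformed_hodgeConjecture_iff_coniveauOne_roof` — **the Hodge conjecture holds iff every smooth
  projective variety is connected by a roof `M ← Z → M₀` of birational morphisms of smooth projective
  varieties to ONE model `M₀` satisfying `C1`** (every birational class of function fields `K/ℂ`
  has a good model), granted the named facts of the companion file plus
  `hodgePQ_independent_of_hodgeModel` and de Rham's theorem `exists_deRhamIsoFamily` (Hodge
  bidegrees of Gysin images).

Literature status. That the coniveau filtration `N¹` in a FIXED degree is a birational invariant
"modulo classes supported on the exceptional divisor" is implicit in Grothendieck's 1969 note and in
every treatment of the blow-up formula (Voisin I, Thm. 7.31); the formulation "the Hodge conjecture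
is equivalent to a statement each of whose instances depends only on the function field
`ℂ(X)` and the integer `p`" is recorded here as a kernel-checked theorem on the tree's carriers.
No step is new mathematics; the packaging (no induction on dimension, no Hodge conjecture for
centres) is the point.

## References

* [GrothendieckTopology1969] A. Grothendieck, Hodge's general conjecture is false for trivial
  reasons, Topology 8 (1969) 299–303, §1 (the filtration by codimension of support).
* [VoisinHodgeI2002] C. Voisin, Hodge Theory and Complex Algebraic Geometry I, CUP 2002, Thm. 7.31,
  Lemma 7.28, §7.3.2.
* [Fulton1998] W. Fulton, Intersection Theory, 2nd ed. 1998, Lemma 19.1.2, §19.2.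
* [DeligneHodgeIII1974] P. Deligne, Théorie de Hodge III, Publ. Math. IHÉS 44 (1974), Cor. 8.2.8.
* [Voisin2025] C. Voisin, The Hodge and generalized Hodge conjectures, coniveau and algebraic cycles
  (2025), §4–5.
-/

open scoped Manifold
open CategoryTheory AlgebraicGeometry
open Literature.AlgebraicTopology.SingularHomology
open Literature.AlgebraicGeometry Literature.AlgebraicGeometry.HodgeTheory
open Literature.NumberTheory.Transcendental (exists_deRhamIsoFamily)

namespace Summit.HodgeConjecture.HodgeConjecture.Theorems

variable {n : ℕ} {Z M : Motives.SchemeOver ℂ}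

/-! ### Bookkeeping: `b_* b^* = id` -/

/-- **`b_* b^* y = y`** for a birational morphism `b : Z ⟶ M` of smooth projective `n`-folds and the
complex orientations: the projection formula `b_*(b^* y ∪ 1) = y ∪ b_* 1` and `b_* 1_Z = 1_M`
(degree one). [cite: Fulton1998, Lemma 19.1.2 and §19.2 (projection formula)]
[cite: VoisinHodgeI2002, Lemma 7.28] -/
theorem soloInformed_complexGysin_map_of_isBirational (hZ : Motives.IsSmoothProjective n Z)
    (hM : Motives.IsSmoothProjective n M) (b : Z ⟶ M) (hb : Resolution.IsBirational b.left)
    {k : ℕ} (hk : k + 2 * n = k + 2 * n) (y : complexBetti M k) :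
    complexGysin complexOrientationFamily hZ hM b hk (complexBetti.map b k y) = y := by
  have hμ : complexOrientationFamily.HasPoincareDuality := hasPoincareDuality_complexOrientationFamily
  have h1 := complexGysin_cup hμ hZ hM b (p := k) (q := 0) (a := k) (b := k) (q' := 0)
    (Nat.add_zero k) hk (rfl : 0 + 2 * n = 0 + 2 * n) (Nat.add_zero k) y
    (singularCohomology.one ℂ (Motives.ComplexPoints Z))
  rw [cupProduct_one, complexGysin_complexOrientationFamily_one_of_isBirational hZ hM b hb,
    cupProduct_one] at h1
  exact h1

/-! ### Ascent and descent of `C1` along a birational morphism -/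

/-- **Ascent.** Let `b : Z ⟶ M` be a birational morphism of smooth projective `n`-folds. If every
rational `(p,p)`-class on `Z` has coniveau `≥ 1`, then so does every rational `(p,p)`-class `c` on `M`:
`c = b_* b^* c` with `b^* c` rational of type `(p,p)` and `b_* N¹(Z) ⊆ N¹(M)` (equal dimensions).
Facts used: `gysinMap_restrictCompl_eq_zero` (Gysin images are supported on images; a theorem over
fields, `gysinMap_restrictCompl_eq_zero_of_field`), `hodgePQ_independent_of_hodgeModel` and
`nonempty_hodgeModel` (pull-backs respect Hodge types). [cite: VoisinHodgeI2002, Lemma 7.28, §7.3.2]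
[cite: GrothendieckTopology1969, §1] -/
theorem soloInformed_coniveauOne_of_isBirational_target
    (hS : gysinMap_restrictCompl_eq_zero.{0, 0} ℂ) (hI : hodgePQ_independent_of_hodgeModel)
    (hHM : ∀ (m : ℕ) (Y : Motives.SchemeOver ℂ), nonempty_hodgeModel m Y)
    (hZ : Motives.IsSmoothProjective n Z) (hM : Motives.IsSmoothProjective n M) (b : Z ⟶ M)
    (hb : Resolution.IsBirational b.left) {p : ℕ}
    (hC : ∀ z : complexBetti Z (2 * p), IsRationalClass z → IsOfHodgeType n Z (2 * p) p p z →
      z ∈ supportedClasses Z (2 * p) 1)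
    (c : complexBetti M (2 * p)) (hc : IsRationalClass c) (hc' : IsOfHodgeType n M (2 * p) p p c) :
    c ∈ supportedClasses M (2 * p) 1 := by
  have hμ : complexOrientationFamily.HasPoincareDuality := hasPoincareDuality_complexOrientationFamily
  have hk : 2 * p + 2 * n = 2 * p + 2 * n := rfl
  have hbc : complexBetti.map b (2 * p) c ∈ supportedClasses Z (2 * p) 1 :=
    hC _ (hc.map (Motives.AlgPoints.mapContinuous (L := ℂ) b))
      (preservesHodgeType_of_nonempty_hodgeModel hI (hHM n Z) hZ hM b hc')
  rw [← soloInformed_complexGysin_map_of_isBirational hZ hM b hb hk c]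
  exact complexGysin_mem_supportedClasses hS complexOrientationFamily hμ hZ hM b hk (r := 1) (s := 1)
    (by omega) hbc

/-- **Descent.** Let `b : Z ⟶ M` be a birational morphism of smooth projective `n`-folds. If every
rational `(p,p)`-class on `M` has coniveau `≥ 1`, then so does every rational `(p,p)`-class `z` on
`Z`. Write `z = b^* y + w` with `w` dying on `(b⁻¹U)(ℂ)`, `U` a dense open over which `b` is an
isomorphism (spanning half of the blow-up formula for a proper modification); `w ∈ N¹(Z)` since
`Z ∖ b⁻¹U` is a proper closed subset; `y = b_* z - b_* w` (from `b_* b^* = id`) lies in `N¹(M)`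
because `b_* z` is a rational `(p,p)`-class (`C1(M)` applies) and `b_* w ∈ N¹(M)`; so
`b^* y ∈ N¹(Z)` and `z ∈ N¹(Z)`. The exceptional classes are never analysed: no Hodge conjecture
for the centre, no induction on dimension. Facts used: as in the ascent, plus de Rham's theorem
(`exists_deRhamIsoFamily`, Hodge bidegrees of Gysin images via `isOfHodgeType_complexGysin`).
[cite: VoisinHodgeI2002, Thm. 7.31 (proof) and §7.3.2] [cite: GrothendieckTopology1969, §1] -/
theorem soloInformed_coniveauOne_of_isBirational_source
    (hS : gysinMap_restrictCompl_eq_zero.{0, 0} ℂ) (hI : hodgePQ_independent_of_hodgeModel)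
    (hHM : ∀ (m : ℕ) (Y : Motives.SchemeOver ℂ), nonempty_hodgeModel m Y)
    (hdR : ∀ (E : Type) [NormedAddCommGroup E] [NormedSpace ℂ E] [FiniteDimensional ℂ E],
      exists_deRhamIsoFamily 𝓘(ℝ, E))
    (hZ : Motives.IsSmoothProjective n Z) (hM : Motives.IsSmoothProjective n M) (b : Z ⟶ M)
    (hb : Resolution.IsBirational b.left) {p : ℕ}
    (hC : ∀ c : complexBetti M (2 * p), IsRationalClass c → IsOfHodgeType n M (2 * p) p p c →
      c ∈ supportedClasses M (2 * p) 1)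
    (z : complexBetti Z (2 * p)) (hz : IsRationalClass z) (hz' : IsOfHodgeType n Z (2 * p) p p z) :
    z ∈ supportedClasses Z (2 * p) 1 := by
  have hμ : complexOrientationFamily.HasPoincareDuality := hasPoincareDuality_complexOrientationFamily
  haveI := irreducibleSpace_of_isSmoothProjective' hZ
  have hk : 2 * p + 2 * n = 2 * p + 2 * n := rfl
  obtain ⟨U, hU, hV, hiso⟩ := id hb
  haveI := hiso
  -- the spanning half of the blow-up formula: `z = b^* y + w`, `w` dying on `(b⁻¹U)(ℂ)`
  obtain ⟨y, hy⟩ := exists_restrictCompl_sub_map_eq_zero_of_isIso_restrict hZ hM b hb U (2 * p) z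
  set w := z - complexBetti.map b (2 * p) y with hw_def
  -- `w ∈ N¹(Z)`: `Z ∖ b⁻¹U` is a proper closed subset
  have hKc : IsClosed ((b.left ⁻¹ᵁ U : Set Z.left))ᶜ := (b.left ⁻¹ᵁ U).2.isClosed_compl
  have hKne : ((b.left ⁻¹ᵁ U : Set Z.left))ᶜ ≠ Set.univ := by
    rw [Ne, Set.compl_univ_iff]
    exact (hV.nonempty).ne_empty
  have hw : w ∈ supportedClasses Z (2 * p) 1 :=
    mem_supportedClasses_of_restrictCompl_eq_zero hKc
      (fun x hx ↦ one_le_coheight_of_mem_of_isClosed hZ hKc hKne hx) hy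
  -- `b_* z` is a rational `(p,p)`-class on `M`, hence in `N¹(M)`; `b_* w ∈ N¹(M)`
  have hβz : complexGysin complexOrientationFamily hZ hM b hk z ∈ supportedClasses M (2 * p) 1 :=
    hC _ (isRationalClass_complexGysin_complexOrientationFamily hZ hM b hk hz)
      (isOfHodgeType_complexGysin hI hHM hdR complexOrientationFamily hZ hM b hk
        (p := p) (q := p) (p' := p) (q' := p) rfl rfl hz')
  have hβw : complexGysin complexOrientationFamily hZ hM b hk w ∈ supportedClasses M (2 * p) 1 :=
    complexGysin_mem_supportedClasses hS complexOrientationFamily hμ hZ hM b hk (r := 1) (s := 1)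
      (by omega) hw
  -- `y = b_* z - b_* w ∈ N¹(M)`
  have hyeq : y = complexGysin complexOrientationFamily hZ hM b hk z -
      complexGysin complexOrientationFamily hZ hM b hk w := by
    rw [hw_def, map_sub, soloInformed_complexGysin_map_of_isBirational hZ hM b hb hk y]
    abel
  have hy1 : y ∈ supportedClasses M (2 * p) 1 := by
    rw [hyeq]
    exact Submodule.sub_mem _ hβz hβw
  -- `b^* y ∈ N¹(Z)` and `z = b^* y + w`
  have hby : complexBetti.map b (2 * p) y ∈ supportedClasses Z (2 * p) 1 :=
    haveI : IsProper b.left := isProper_left_of_isSmoothProjective hZ hM b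
    map_mem_supportedClasses_one_of_surjective hZ hM b (surjective_base_of_isBirational b.left hb) hy1
  have hzeq : z = complexBetti.map b (2 * p) y + w := by rw [hw_def]; abel
  rw [hzeq]
  exact Submodule.add_mem _ hby hw

/-- **`C1(n, p)` is a birational invariant**: for a birational morphism `b : Z ⟶ M` of smooth
projective `n`-folds, every rational `(p,p)`-class on `M` has coniveau `≥ 1` iff every rational
`(p,p)`-class on `Z` does. [cite: VoisinHodgeI2002, Thm. 7.31] [cite: GrothendieckTopology1969, §1] -/
theorem soloInformed_coniveauOne_iff_of_isBirational
    (hS : gysinMap_restrictCompl_eq_zero.{0, 0} ℂ) (hI : hodgePQ_independent_of_hodgeModel)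
    (hHM : ∀ (m : ℕ) (Y : Motives.SchemeOver ℂ), nonempty_hodgeModel m Y)
    (hdR : ∀ (E : Type) [NormedAddCommGroup E] [NormedSpace ℂ E] [FiniteDimensional ℂ E],
      exists_deRhamIsoFamily 𝓘(ℝ, E))
    (hZ : Motives.IsSmoothProjective n Z) (hM : Motives.IsSmoothProjective n M) (b : Z ⟶ M)
    (hb : Resolution.IsBirational b.left) (p : ℕ) :
    (∀ c : complexBetti M (2 * p), IsRationalClass c → IsOfHodgeType n M (2 * p) p p c →
        c ∈ supportedClasses M (2 * p) 1) ↔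
      ∀ z : complexBetti Z (2 * p), IsRationalClass z → IsOfHodgeType n Z (2 * p) p p z →
        z ∈ supportedClasses Z (2 * p) 1 :=
  ⟨fun hC ↦ soloInformed_coniveauOne_of_isBirational_source hS hI hHM hdR hZ hM b hb hC,
    fun hC ↦ soloInformed_coniveauOne_of_isBirational_target hS hI hHM hZ hM b hb hC⟩

/-! ### The Hodge conjecture as a statement about birational classes -/

/-- **The Hodge conjecture holds iff every birational class has a model of coniveau one.**
Granted the named facts, `HodgeConjecture` is equivalent to: every smooth projective `n`-fold `M`
is joined by a roof `M ⟵ Z ⟶ M₀` of birational morphisms of smooth projective `n`-folds to a model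
`M₀` on which every rational `(p,p)`-class with `2 ≤ p`, `2p ≤ n` has coniveau `≥ 1`. (Any two
birationally equivalent smooth projective varieties are so joined — resolve the closure of the graph
— so each instance of the right-hand side depends only on the function field `ℂ(M)` and on `p`.)
[cite: GrothendieckTopology1969, pp. 300–301] [cite: VoisinHodgeI2002, Thm. 7.31]
[cite: Voisin2025, §4 (Conj. 4.6)] -/
theorem soloInformed_hodgeConjecture_iff_coniveauOne_roof
    (hA : Deligne1974_ker_restrictCompl_eq_iSup_range_complexGysin)
    (hB : Voisin2025_hodgeClass_lift_complexGysin)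
    (hS : gysinMap_restrictCompl_eq_zero.{0, 0} ℂ)
    (hH : Resolution.Hironaka1964_projective.{0})
    (hL : lefschetzOneOne_rational)
    (hHM : ∀ (m : ℕ) (Y : Motives.SchemeOver ℂ), nonempty_hodgeModel m Y)
    (hI : hodgePQ_independent_of_hodgeModel)
    (hdR : ∀ (E : Type) [NormedAddCommGroup E] [NormedSpace ℂ E] [FiniteDimensional ℂ E],
      exists_deRhamIsoFamily 𝓘(ℝ, E)) :
    _root_.HodgeConjecture ↔
      ∀ ⦃n : ℕ⦄ ⦃M : Motives.SchemeOver ℂ⦄, Motives.IsSmoothProjective n M →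
        ∃ (Z M₀ : Motives.SchemeOver ℂ) (b : Z ⟶ M) (b₀ : Z ⟶ M₀),
          Motives.IsSmoothProjective n Z ∧ Motives.IsSmoothProjective n M₀ ∧
          Resolution.IsBirational b.left ∧ Resolution.IsBirational b₀.left ∧
          ∀ (p : ℕ) (c : complexBetti M₀ (2 * p)), 2 ≤ p → 2 * p ≤ n → IsRationalClass c →
            IsOfHodgeType n M₀ (2 * p) p p c → c ∈ supportedClasses M₀ (2 * p) 1 := by
  rw [soloInformed_hodgeConjecture_iff_coniveauOne hA hB hS hH hL hHM]
  constructor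
  · intro h n M hM
    exact ⟨M, M, 𝟙 M, 𝟙 M, hM, hM, isBirational_of_isIso' _,
      isBirational_of_isIso' _, fun p c hp hpn hc hc' ↦ h hM p c hp hpn hc hc'⟩
  · intro h n M hM p c hp hpn hc hc'
    obtain ⟨Z, M₀, b, b₀, hZ, hM₀, hb, hb₀, h₀⟩ := h hM
    have hCZ : ∀ z : complexBetti Z (2 * p), IsRationalClass z → IsOfHodgeType n Z (2 * p) p p z →
        z ∈ supportedClasses Z (2 * p) 1 :=
      soloInformed_coniveauOne_of_isBirational_source hS hI hHM hdR hZ hM₀ b₀ hb₀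
        (fun c hc hc' ↦ h₀ p c hp hpn hc hc')
    exact soloInformed_coniveauOne_of_isBirational_target hS hI hHM hZ hM b hb hCZ c hc hc'

end Summit.HodgeConjecture.HodgeConjecture.Theorems
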